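import Summits.QuantumAdvantage.QuantumAdvantage.Theses.CubicForrelation
import Literature.Computability.QuantumComplexity.SignedCubicForrelation
import Literature.Computability.QuantumComplexity.SignedForrelationMem
import Literature.Computability.Complexity.CircuitComposition

/-!
# `SignedExactSliceIsLift` (stmt-QuantumAdvantage-14830), negative side —
# degree-blind reading of the landed family is UNGAPPED at every power

Negative-side (cdisprove) lemmas for crux K2 `SignedExactSliceIsLift` and its picked line
`reduce-then-lift` (Cruxes/SignedExactSliceIsLift/PICKED.md). The line's stub C (TotalCanonicaliser) must
PROJECT every code to a degree-≤3 code (Möbius interpolation) before the landed signed family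
`PhaseQuery.family SgnForrMem.paramsS` (AND-powered `K` times, stub A) reads it. This file certifies that
the projection is LOAD-BEARING — the recorded trap "a family reading `C.eval` directly is not gapped off
the promise" (PlLift triage r1-1, rattack-14830) as a theorem about the landed objects:

* `exists_allRead_code_value` : for every `t ≥ 1` there is a `B₂` instance with `k = 2`, `n = 2t` even,
  EVERY input wire read (`n ≤ #R`, a fortiori the line's `n ≤ #R + 1`), value
  `Φ = 1 − 2/4^t ∈ [1/2, 1)` — so its code is on NEITHER side of the exact slice — on which the landed
  family accepts with probability `≥ 1 − 2/4^t` (functions: `g = ⟨y′,y″⟩` the inner-product bent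
  function, `f = g ⊕ [x = 0]`, of full degree `2t`; circuits from the universal `B₂` bound).
* `degreeBlind_andPower_ungapped` : consequently for EVERY `K` there is such an off-slice, all-wires-read,
  even-`n`, `k = 2` code `x` with `acc(x)^K > 1/3`: no constant AND-power of the landed family composed
  with a canonicaliser that keeps well-formed codes of ALL degrees decides a separating language —
  degree projection (or isolation in another guise) is where `NearExactIsExact` enters.

Helpers: `n_le_sR_of_depends` (semantic dependence on every wire ⇒ every wire is read: `#R = n`),
the exact acceptance off the promise (private copies of the lemmas of `LandedFamilyUngapped.lean`).
No definitions are introduced (the indicator vectors `e_j` and `f` are written as lambdas).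
-/

noncomputable section

set_option linter.dupNamespace false -- D-0017: single-problem summit ⇒ `QuantumAdvantage.QuantumAdvantage` by design

open Finset
open Literature.Computability.Complexity Literature.Computability.Cryptography
open Literature.Computability.QuantumComplexity
open Literature.Computability.QuantumComplexity.PhaseQuery
open Literature.Computability.QuantumComplexity.ForrMem
open Literature.Computability.QuantumComplexity.SgnForrMem
open Literature.Computability.QuantumComplexity.DerivativeWalsh (W)

namespace Summit.QuantumAdvantage.QuantumAdvantage.Theorems.SignedExactSliceIsLift.Negative

/-! ### Exact acceptance off the promise (private copies; public versions in `LandedFamilyUngapped`) -/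

/-- Exact modulus of the return amplitude off the promise (private copy; public version
`norm_phiFin_of_le` in `LandedFamilyUngapped.lean`). [cite: AaronsonAmbainis2018, §3.2 Prop. 6] -/
private theorem norm_phiFin_of_le' (I : KForrelationInstance) (hk : I.k = 2) (he : Even I.n)
    (h : I.n ≤ sR I + 1) (A : Language Bool) :
    ‖phiFin paramsS specS I.encode A fun _ => false‖ = (1 + I.value) / 2 := by
  obtain ⟨hq, hq0⟩ := isSelfDualBent_qM (even_WdS_of_le I h)
  have e : forrelation (fun w : Fin (WdS I) → Bool => cfun I 0 w) (fun w => cfun I 1 w) = I.value := by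
    rw [forrelation_cfun I hk (WdS I) (sR_le_WdS I), value_eq, hk, WdS_eq_of_le I h, if_pos he,
      Nat.add_zero]
  rw [phiFin_encode I hk, gS_vec, Complex.norm_real, Real.norm_eq_abs]
  have hg := kForrelationValue_gadget (fun w : Fin (WdS I) → Bool => cfun I 0 w) (fun w => cfun I 1 w)
    (qW I) hq hq0
  simp only at hg
  rw [show (qW I) = fun w => qW I w from rfl] at hg
  erw [hg, abs_gadget, e]

/-- Exact acceptance off the promise (private copy; public version `acceptProbOn_of_le` in
`LandedFamilyUngapped.lean`). [cite: AaronsonAmbainis2018, §3.2 Prop. 6] -/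
private theorem acceptProbOn_of_le' (I : KForrelationInstance) (hk : I.k = 2) (he : Even I.n)
    (h : I.n ≤ sR I + 1) :
    (family paramsS).acceptProbOn 0 I.encode = 1 - (1 - ((1 + I.value) / 2) ^ 2) ^ 3 := by
  rw [acceptProbOn_family paramsS specS I.encode 0, norm_phiFin_of_le' I hk he h]

/-! ### Semantic dependence forces syntactic reads -/

/-- **If some circuit of the instance depends on every input wire, every wire is read: `n ≤ #R`.**
(`eval_congr_reads`: a circuit's value depends only on the wires it reads; `rank` is injective on read
wires with values `< #R`.) [folklore] -/
theorem n_le_sR_of_depends (I : KForrelationInstance)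
    (h : ∀ i : Fin I.n, ∃ t : Fin I.k, ∃ x x' : Fin I.n → Bool,
      (∀ l, l ≠ i → x l = x' l) ∧ (I.C t).eval x ≠ (I.C t).eval x') :
    I.n ≤ sR I := by
  have hread : ∀ i : Fin I.n, i.val ∈ occList I := by
    intro i
    obtain ⟨t, x, x', hxx', hne⟩ := h i
    refine mem_occList_of_mem_readsC I t ?_
    by_contra hi
    exact hne (eval_congr_reads (I.C t) fun l hl => hxx' l fun e => hi (e ▸ hl))
  let φ : Fin I.n → Fin (sR I) := fun i => ⟨rank I i, rank_lt_of_mem I (hread i)⟩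
  have hφ : Function.Injective φ := fun i i' e =>
    rank_injOn I (rank_lt_of_mem I (hread i)) (by simpa [φ] using congrArg Fin.val e)
  simpa using Fintype.card_le_of_injective φ hφ

/-! ### The functions: the inner-product bent function and its one-point perturbation -/

/-- `(-1)^{⟨e_j, e_j⟩} = -1`. [folklore] -/
private theorem twist_eV_eV {t : ℕ} (j : Fin t) : twist (fun i : Fin t => decide (i = j)) (fun i => decide (i = j)) = -1 := by
  unfold twist
  rw [Finset.prod_eq_single j]
  · simp
  · intro b _ hb; simp [hb]
  · simp

/-- `(-1)^{⟨0, v⟩} = 1`. [folklore] -/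
private theorem twist_zero_left' {t : ℕ} (v : Fin t → Bool) : twist (fun _ => false) v = 1 := by
  simp [twist]

/-- `ipHalf` depends on every LEFT wire: flipping `y′_j` at `(0, e_j)` flips the value. [folklore] -/
private theorem ipHalf_depends_left (t : ℕ) (j : Fin t) :
    ipHalf t (Fin.append (fun _ => false) (fun i => decide (i = j))) ≠ ipHalf t (Fin.append (fun i => decide (i = j)) (fun i => decide (i = j))) := by
  intro e
  have h1 := signOf_ipHalf_append (fun _ : Fin t => false) (fun i => decide (i = j))
  have h2 := signOf_ipHalf_append (fun i => decide (i = j)) (fun i => decide (i = j))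
  rw [twist_zero_left'] at h1
  rw [twist_eV_eV] at h2
  rw [e, h2] at h1
  norm_num at h1

/-- `ipHalf` depends on every RIGHT wire: flipping `y″_j` at `(e_j, 0)` flips the value. [folklore] -/
private theorem ipHalf_depends_right (t : ℕ) (j : Fin t) :
    ipHalf t (Fin.append (fun i => decide (i = j)) (fun _ => false)) ≠ ipHalf t (Fin.append (fun i => decide (i = j)) (fun i => decide (i = j))) := by
  intro e
  have h1 := signOf_ipHalf_append (fun i => decide (i = j)) (fun _ : Fin t => false)
  have h2 := signOf_ipHalf_append (fun i => decide (i = j)) (fun i => decide (i = j))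
  rw [twist_zero_right] at h1
  rw [twist_eV_eV] at h2
  rw [e, h2] at h1
  norm_num at h1

/-- `∑_y (-1)^{[y = 0]} = 2^{n} - 2`. [folklore] -/
private theorem sum_signOf_delta (n : ℕ) :
    ∑ y : Fin n → Bool, signOf (decide (y = fun _ => false)) = (2 : ℝ) ^ n - 2 := by
  have e : ∀ y : Fin n → Bool, signOf (decide (y = fun _ => false)) =
      1 - 2 * (if y = (fun _ => false) then (1 : ℝ) else 0) := by
    intro y; by_cases hy : y = fun _ => false <;> simp [hy, signOf]; norm_num
  rw [Finset.sum_congr rfl fun y _ => e y, Finset.sum_sub_distrib, Finset.sum_const, ← Finset.mul_sum,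
    Finset.sum_ite_eq' Finset.univ (fun _ : Fin n => false) (fun _ => (1 : ℝ)), if_pos (Finset.mem_univ _)]
  simp [Fintype.card_bool, Fintype.card_fin]

/-- **`Φ(ipHalf, ipHalf ⊕ δ₀) = 1 − 2/4^t`** (bent absorption: `W_{ipHalf} = 2^t (-1)^{ipHalf}`).
[cite: AaronsonAmbainis2018, §1.1.1] -/
theorem forrelation_ipHalf_pert (t : ℕ) :
    forrelation (ipHalf t) (fun x => xor (ipHalf t x) (decide (x = fun _ => false))) =
      1 - 2 / (4 : ℝ) ^ t := by
  rw [forrelation_eq_sum_W]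
  have hq := isSelfDualBent_ipHalf t
  have e : ∀ y : Fin (t + t) → Bool, signOf (xor (ipHalf t y) (decide (y = fun _ => false))) *
      W (fun x => signOf (ipHalf t x)) y = Real.sqrt (2 ^ (t + t)) * signOf (decide (y = fun _ => false)) := by
    intro y
    rw [hq y, signOf_xor]
    have hs : signOf (ipHalf t y) * signOf (ipHalf t y) = 1 := by
      cases ipHalf t y <;> simp [signOf]
    calc signOf (ipHalf t y) * signOf (decide (y = fun _ => false)) * (Real.sqrt (2 ^ (t + t)) * signOf (ipHalf t y))
        = (signOf (ipHalf t y) * signOf (ipHalf t y)) * (Real.sqrt (2 ^ (t + t)) * signOf (decide (y = fun _ => false))) := by ring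
      _ = _ := by rw [hs, one_mul]
  rw [Finset.sum_congr rfl fun y _ => e y, ← Finset.mul_sum, sum_signOf_delta, sqrt_two_pow_add_self,
    show 3 * (t + t) = 3 * t + 3 * t by ring, sqrt_two_pow_add_self]
  have h2 : (2 : ℝ) ^ t ≠ 0 := by positivity
  have h4 : (4 : ℝ) ^ t = 2 ^ t * 2 ^ t := by rw [← mul_pow]; norm_num
  rw [h4, show (2 : ℝ) ^ (3 * t) = 2 ^ t * 2 ^ t * 2 ^ t by rw [← pow_add, ← pow_add]; ring_nf,
    show (2 : ℝ) ^ (t + t) = 2 ^ t * 2 ^ t by rw [pow_add]]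
  field_simp

/-! ### The instances -/

/-- **All-wires-read `B₂` instances with value `1 − 2/4^t`**: for every `t ≥ 1` there is a `B₂`
instance, `k = 2`, `n = t + t` (even), EVERY wire read (`n ≤ #R`), with `Φ = 1 − 2/4^t` — off the exact
slice on both sides — accepted by the landed signed family with probability `≥ 1 − 2/4^t`.
[cite: AaronsonAmbainis2018, §3.2 Prop. 6] -/
theorem exists_allRead_code_value (t : ℕ) (ht : 1 ≤ t) :
    ∃ I : KForrelationInstance, I.IsOverB2 ∧ I.k = 2 ∧ I.n = t + t ∧ Even I.n ∧ I.n ≤ sR I ∧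
      I.value = 1 - 2 / (4 : ℝ) ^ t ∧
      I.encode ∉ (signedExactCubicForrelationProblem 2).yes ∧
      I.encode ∉ (signedExactCubicForrelationProblem 2).no ∧
      1 - 2 / (4 : ℝ) ^ t ≤ (family paramsS).acceptProbOn 0 I.encode := by
  -- circuits from the universal bound
  obtain ⟨Cg, hCgB, -, hCg⟩ := (cktSize_univ (ι := Fin (t + t)) fun x (_ : Unit) => ipHalf t x).toCircuit
  obtain ⟨Cf, hCfB, -, hCf⟩ := (cktSize_univ (ι := Fin (t + t)) fun x (_ : Unit) => xor (ipHalf t x) (decide (x = fun _ => false))).toCircuit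
  set I : KForrelationInstance := ⟨t + t, 2, ![Cg, Cf]⟩ with hI
  have hB2 : I.IsOverB2 := by
    intro i; fin_cases i
    · exact hCgB
    · exact hCfB
  have he : Even I.n := ⟨t, rfl⟩
  -- every wire is read (circuit 0 computes ipHalf, which depends on every wire)
  have hdep : ∀ i : Fin I.n, ∃ s : Fin I.k, ∃ x x' : Fin I.n → Bool,
      (∀ l, l ≠ i → x l = x' l) ∧ (I.C s).eval x ≠ (I.C s).eval x' := by
    intro i
    refine ⟨0, ?_⟩
    show ∃ x x' : Fin (t + t) → Bool, (∀ l, l ≠ i → x l = x' l) ∧ Cg.eval x ≠ Cg.eval x'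
    simp only [hCg]
    induction i using Fin.addCases with
    | left j =>
      refine ⟨Fin.append (fun _ => false) (fun i => decide (i = j)), Fin.append (fun i => decide (i = j)) (fun i => decide (i = j)), fun l hl => ?_,
        ipHalf_depends_left t j⟩
      induction l using Fin.addCases with
      | left m =>
        have hm : m ≠ j := fun e => hl (by rw [e])
        rw [Fin.append_left, Fin.append_left]
        simp [hm]
      | right m => rw [Fin.append_right, Fin.append_right]
    | right j =>
      refine ⟨Fin.append (fun i => decide (i = j)) (fun _ => false), Fin.append (fun i => decide (i = j)) (fun i => decide (i = j)), fun l hl => ?_,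
        ipHalf_depends_right t j⟩
      induction l using Fin.addCases with
      | left m => rw [Fin.append_left, Fin.append_left]
      | right m =>
        have hm : m ≠ j := fun e => hl (by rw [e])
        rw [Fin.append_right, Fin.append_right]
        simp [hm]
  have hle : I.n ≤ sR I := n_le_sR_of_depends I hdep
  have hval : I.value = 1 - 2 / (4 : ℝ) ^ t := by
    rw [hI, KForrelationInstance.value_mk_two]
    simp only [Matrix.cons_val_zero, Matrix.cons_val_one]
    rw [show Cg.eval = ipHalf t from funext fun x => hCg x,
      show Cf.eval = (fun x => xor (ipHalf t x) (decide (x = fun _ => false))) from funext fun x => hCf x]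
    exact forrelation_ipHalf_pert t
  have h4 : (4 : ℝ) ≤ 4 ^ t := by
    calc (4 : ℝ) = 4 ^ 1 := by norm_num
      _ ≤ 4 ^ t := pow_le_pow_right₀ (by norm_num) ht
  have h4pos : (0 : ℝ) < 4 ^ t := by positivity
  have hlt1 : I.value < 1 := by rw [hval]; have := div_pos (two_pos (α := ℝ)) h4pos; linarith
  have hge : (1 : ℝ) / 2 ≤ I.value := by
    have : 2 / (4 : ℝ) ^ t ≤ 1 / 2 := by rw [div_le_iff₀ h4pos]; linarith
    rw [hval]; linarith
  refine ⟨I, hB2, rfl, rfl, he, hle, hval, ?_, ?_, ?_⟩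
  · rintro ⟨J, hJ, hJI⟩
    obtain rfl := KForrelationInstance.encode_injective hJI
    exact absurd hJ.2.1 hlt1.ne
  · rintro ⟨J, hJ, hJI⟩
    obtain rfl := KForrelationInstance.encode_injective hJI
    have := hJ.2.1; linarith
  · rw [acceptProbOn_of_le' I rfl he (Nat.le_succ_of_le hle), hval]
    -- `1 − (1 − M²)³ ≥ M² ≥ 1 − 2/4^t` with `M = 1 − 1/4^t`
    set a : ℝ := 2 / 4 ^ t with ha
    have ha0 : 0 ≤ a := by positivity
    have ha1 : a ≤ 1 / 2 := by rw [ha, div_le_iff₀ h4pos]; linarith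
    have hM : (1 + (1 - a)) / 2 = 1 - a / 2 := by ring
    rw [hM]
    have hM0 : 0 ≤ 1 - (1 - a / 2) ^ 2 := by nlinarith
    have hM1 : 1 - (1 - a / 2) ^ 2 ≤ 1 := by nlinarith
    have hc : (1 - (1 - a / 2) ^ 2) ^ 3 ≤ (1 - (1 - a / 2) ^ 2) := by
      calc (1 - (1 - a / 2) ^ 2) ^ 3 = (1 - (1 - a / 2) ^ 2) * ((1 - (1 - a / 2) ^ 2) * (1 - (1 - a / 2) ^ 2)) := by ring
        _ ≤ (1 - (1 - a / 2) ^ 2) * 1 := by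
          apply mul_le_mul_of_nonneg_left _ hM0
          nlinarith
        _ = _ := mul_one _
    nlinarith

/-! ### Consequence: no degree-blind AND-power of the landed family is gapped -/

/-- **Degree projection is load-bearing.** For every `K` there is an all-wires-read, even-`n`, `k = 2`
`B₂` code OFF the exact slice (value in `[1/2, 1)`) accepted by the `K`-th AND-power of the landed family
with probability `> 1/3`: a separating language can be decided by `(AND-power of F₀) ∘ f` only if the
canonicaliser `f` does NOT fix such codes — it must project to a value set with a gap below `1`
(degree `≤ 3` + `NearExactIsExact` in the picked line). [cite: AaronsonAmbainis2018, §3.2 Prop. 6] -/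
theorem degreeBlind_andPower_ungapped (K : ℕ) :
    ∃ I : KForrelationInstance, I.IsOverB2 ∧ I.k = 2 ∧ Even I.n ∧ I.n ≤ sR I ∧
      (1 : ℝ) / 2 ≤ I.value ∧ I.value < 1 ∧
      I.encode ∉ (signedExactCubicForrelationProblem 2).yes ∧
      I.encode ∉ (signedExactCubicForrelationProblem 2).no ∧
      (1 : ℝ) / 3 < (family paramsS).acceptProbOn 0 I.encode ^ K := by
  obtain ⟨I, hB, hk, hn, he, hle, hval, hy, hno, hacc⟩ := exists_allRead_code_value (K + 1) (Nat.succ_pos K)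
  have h4pos : (0 : ℝ) < 4 ^ (K + 1) := by positivity
  have h4 : (4 : ℝ) ≤ 4 ^ (K + 1) := by
    calc (4 : ℝ) = 4 ^ 1 := by norm_num
      _ ≤ 4 ^ (K + 1) := pow_le_pow_right₀ (by norm_num) (Nat.le_add_left 1 K)
  have hge : (1 : ℝ) / 2 ≤ I.value := by
    have : 2 / (4 : ℝ) ^ (K + 1) ≤ 1 / 2 := by rw [div_le_iff₀ h4pos]; linarith
    rw [hval]; linarith
  have hlt : I.value < 1 := by rw [hval]; have := div_pos (two_pos (α := ℝ)) h4pos; linarith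
  refine ⟨I, hB, hk, he, hle, hge, hlt, hy, hno, ?_⟩
  -- Bernoulli: `(1 − 2/4^{K+1})^K ≥ 1 − 2K/4^{K+1} > 1/3` since `3K < 4^{K+1}`
  set a : ℝ := 2 / 4 ^ (K + 1) with ha
  have ha0 : 0 ≤ a := by positivity
  have ha1 : a ≤ 1 / 2 := by rw [ha, div_le_iff₀ h4pos]; linarith
  have hbase : 0 ≤ 1 - a := by linarith
  have hpow : (1 - a) ^ K ≤ (family paramsS).acceptProbOn 0 I.encode ^ K := pow_le_pow_left₀ hbase hacc K
  have hbern : 1 + (K : ℝ) * (-a) ≤ (1 + (-a)) ^ K := one_add_mul_le_pow (by linarith) K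
  have hKa : (K : ℝ) * a < 2 / 3 := by
    have hK4 : (3 : ℝ) * K < 4 ^ (K + 1) := by
      have h1 : (K : ℝ) < 4 ^ K := by exact_mod_cast Nat.lt_pow_self (by norm_num : 1 < 4)
      rw [pow_succ]; nlinarith [pow_pos (show (0:ℝ) < 4 by norm_num) K]
    rw [ha, mul_div_assoc', div_lt_iff₀ h4pos]
    linarith
  have : (1 : ℝ) / 3 < (1 - a) ^ K := by
    rw [show (1 : ℝ) - a = 1 + (-a) by ring]
    linarith
  exact this.trans_le hpow

end Summit.QuantumAdvantage.QuantumAdvantage.Theorems.SignedExactSliceIsLift.Negative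

end
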